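import Literature.Combinatorics.Enumerative.MultivariateAperyGZeroProofs
import Literature.Combinatorics.Enumerative.MultivariateAperyJacobsthalRatioProofs
import Mathlib.Tactic
import HarnessLib

/-!
# Straub 2014, Theorem 1.2 for general `r` (PROVED): `A(p^r 𝐧) ≡ A(p^{r−1} 𝐧) (mod p^{3r})`, and Coster's supercongruence for the Apéry numbers

Topic `Literature/Combinatorics/Enumerative`, namespace `Literature.Combinatorics.Enumerative.MultivariateAperyPrimePowerProofs`
(the last of `MultivariateAperyDigitReductionProofs` / `…JacobsthalRatioProofs` → `…GZeroProofs` → this file).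
PROOF FILE: sorry-free theorems only — no definition, no named fact. It DISCHARGES the named facts
`MultivariateAperyNumbers.theorem12` and `MultivariateAperyNumbers.coster1988_supercongruence` of the statement
file `MultivariateAperyNumbers.lean` (whose docstring holds the verbatim statements); the tree previously had
the case `r = 1` only (`MultivariateAperySupercongruenceProofs`, Gessel's route), its docstring naming the missing
input: «Straub's own proof (Lemmas 5.3–5.6, uniform in `r`) needs Jacobsthal's congruence modulo
`p^{r+s+min(r,s)}`, which the tree does not have beyond `p³`» — now `NumberTheory/Congruences/Jacobsthal*`.
Source read on the page (held `paper:arxiv-1401.0854`): A. Straub, *Multivariate Apéry numbers and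
supercongruences of rational functions*, Algebra & Number Theory **8** (2014) 1985–2008 [Straub2014]; the
supercongruence (2) is M. Coster, *Supercongruences*, thesis, Leiden (1988) [Coster1988] (not held; as cited in
[Straub2014]). HONEST FRAMING (cell pub-zeta5): prime-power supercongruences for the Apéry numbers of `ζ(3)`
(KNOWN theorems, 1988/2014); nothing here concerns `ζ(5)`, its approximations, or any irrationality statement.

## What is printed (verbatim, [Straub2014])

«Theorem 1.2. Let `𝐧 = (n₁, n₂, n₃, n₄) ∈ ℤ⁴`. The coefficients `A(𝐧)`, defined in (7) and extended to negative
integers by (8), satisfy, for primes `p ≥ 5` and positive integers `r`, the supercongruences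
(9) `A(p^r 𝐧) ≡ A(p^{r−1} 𝐧) (mod p^{3r})`.» and (2) «`A(p^r m) ≡ A(p^{r−1} m) (mod p^{3r})` … the general case
has been proved by M. Coster». Proof of Theorem 1.2: «In terms of the numbers `A_{λ,ε}(𝐧; k)` … we have
`A_{λ,ε}(𝐧) = Σ_{k≥0} ε^k A_λ(𝐧; k) = Σ_{s≥0} G_s(𝐧)`, where `G_s(𝐧) = Σ_{p∤k} ε^{p^s k} A_λ(𝐧; p^s k)`. …
It again follows from `ε^{p^s k} = ε^{p^{s−1} k}` and Lemma 5.3 that, for `s ≥ 1`,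
`G_s(p^r 𝐧) ≡ G_{s−1}(p^{r−1} 𝐧) (mod p^{3r})`. To prove that `A_{λ,ε}(p^r 𝐧) ≡ A_{λ,ε}(p^{r−1} 𝐧)` modulo
`p^{3r}`, we have to show that `G₀(p^r 𝐧) ≡ 0` modulo `p^{3r}`.»

## What is proved (λ = (2,2), ε = 1, `𝐧 ∈ ℤ_{≥0}^4` — the typed scope of the named fact)

* `sum_eq_sum_digits` — the regrouping `Σ_{K ≤ N} F(K) = F(0) + Σ_{s ≤ S} Σ_{p∤k ≤ N} F(p^s k)` by the `p`-adic
  valuation of `K` (for `F` vanishing beyond `N < p^{S+1}`); the printed display keeps the term `k = 0` inside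
  `Σ_{k≥0}` — here it is split off and treated by Jacobsthal's congruence (36)
  (`Jacobsthal.choose_mul_prime_pow_modEq`), since `A(p^r 𝐧; 0) = C(p^r(n₁+n₂), p^r n₁) C(p^r(n₃+n₄), p^r n₃)`.
* **`straubA_prime_pow_modEq`** — (9); **`theorem12_holds : MultivariateAperyNumbers.theorem12`**;
  **`coster1988_supercongruence_holds : MultivariateAperyNumbers.coster1988_supercongruence`** (by the tree's
  `coster1988_of_theorem12`).

Not here: the signed case `ε = −1`, λ = (2,1) ((25), `example34_supercongruence`), `𝐧` with negative entries
(Beukers' (3)), the Osburn–Sahu–Straub family — TODO for a successor; all inputs except the λ = (2,1)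
analogues of `term_modEq`, `companion_modEq`, `pow_dvd_sum_not_dvd_term` are in place.
-/

open Finset

namespace Literature.Combinatorics.Enumerative.MultivariateAperyPrimePowerProofs

open MultivariateAperyNumbers (straubA)
open Literature.NumberTheory.Congruences (Jacobsthal.choose_mul_prime_pow_modEq)

section Assembly

variable {p : ℕ} [hp : Fact p.Prime]

/-- **`A(𝐧) = Σ_{k≥0} A(𝐧;k) = A(𝐧;0) + Σ_{s≥0} G_s(𝐧)`, `G_s(𝐧) = Σ_{p∤k} A(𝐧; p^s k)`** — regrouping a
finite sum by the `p`-adic valuation of the index: for `F` vanishing beyond `N` and `N < p^{S+1}`,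
`Σ_{K ≤ N} F(K) = F(0) + Σ_{s ≤ S} Σ_{k ≤ N, p∤k} F(p^s k)`. [cite: Straub2014, Theorem 1.2 (proof, first display)] -/
theorem sum_eq_sum_digits {N S : ℕ} (hN : N < p ^ (S + 1)) (F : ℕ → ℤ) (hF : ∀ K, N < K → F K = 0) :
    ∑ K ∈ range (N + 1), F K =
      F 0 + ∑ s ∈ range (S + 1), ∑ k ∈ range (N + 1), (if p ∣ k then 0 else F (p ^ s * k)) := by
  have hp' := hp.out
  classical
  set D := ((range (S + 1)) ×ˢ (range (N + 1))).filter (fun q : ℕ × ℕ => ¬ p ∣ q.2) with hD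
  set φ : ℕ × ℕ → ℕ := fun q => p ^ q.1 * q.2 with hφ
  -- the double sum is a sum over the image of `(s, k) ↦ p^s k`
  have hrhs : ∑ s ∈ range (S + 1), ∑ k ∈ range (N + 1), (if p ∣ k then (0 : ℤ) else F (p ^ s * k)) =
      ∑ q ∈ D, F (φ q) := by
    rw [hD, Finset.sum_filter, ← Finset.sum_product']
    refine Finset.sum_congr rfl fun q _ => ?_
    by_cases h : p ∣ q.2
    · rw [if_pos h, if_neg (not_not.mpr h)]
    · rw [if_neg h, if_pos h]
  have hinj : Set.InjOn φ ↑D := by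
    rintro ⟨s, k⟩ hq ⟨s', k'⟩ hq' h
    simp only [hD, Finset.coe_filter, Finset.mem_product, Finset.mem_range, Set.mem_setOf_eq] at hq hq'
    simp only [hφ] at h
    have hk0 : k ≠ 0 := fun h0 => hq.2 (h0 ▸ dvd_zero p)
    have hk0' : k' ≠ 0 := fun h0 => hq'.2 (h0 ▸ dvd_zero p)
    have hv := congrArg (padicValNat p) h
    rw [padicValNat.mul (pow_ne_zero _ hp'.ne_zero) hk0, padicValNat.mul (pow_ne_zero _ hp'.ne_zero) hk0',
      padicValNat.prime_pow, padicValNat.prime_pow, padicValNat.eq_zero_of_not_dvd hq.2,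
      padicValNat.eq_zero_of_not_dvd hq'.2] at hv
    simp only [add_zero] at hv
    subst hv
    have := Nat.eq_of_mul_eq_mul_left (pow_pos hp'.pos s) h
    subst this
    rfl
  rw [hrhs, ← Finset.sum_image hinj]
  -- the left sum: split off `K = 0`, then compare index sets
  rw [Finset.range_eq_Ico, Finset.sum_eq_sum_Ico_succ_bot (Nat.succ_pos N)]
  congr 1
  apply Finset.sum_subset
  · -- `[1, N] ⊆ image`
    intro K hK
    rw [Finset.mem_Ico] at hK
    have hK0 : K ≠ 0 := by omega
    rw [Finset.mem_image]
    refine ⟨(padicValNat p K, K / p ^ padicValNat p K), ?_, Nat.mul_div_cancel' pow_padicValNat_dvd⟩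
    simp only [hD, Finset.mem_filter, Finset.mem_product, Finset.mem_range]
    refine ⟨⟨?_, ?_⟩, ?_⟩
    · have h1 : p ^ padicValNat p K ≤ K := Nat.le_of_dvd (by omega) pow_padicValNat_dvd
      exact (Nat.pow_lt_pow_iff_right hp'.one_lt).mp (by omega)
    · have := Nat.div_le_self K (p ^ padicValNat p K); omega
    · intro hdvd
      obtain ⟨c, hc⟩ := hdvd
      apply pow_succ_padicValNat_not_dvd (p := p) hK0
      refine ⟨c, ?_⟩
      calc K = p ^ padicValNat p K * (K / p ^ padicValNat p K) := (Nat.mul_div_cancel' pow_padicValNat_dvd).symm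
        _ = p ^ padicValNat p K * (p * c) := by rw [hc]
        _ = p ^ (padicValNat p K + 1) * c := by ring
  · -- terms of the image outside `[1, N]` vanish
    intro K hK hK'
    rw [Finset.mem_image] at hK
    obtain ⟨⟨s, k⟩, hq, rfl⟩ := hK
    simp only [hD, Finset.mem_filter, Finset.mem_product, Finset.mem_range] at hq
    simp only [hφ, Finset.mem_Ico, not_and_or, not_le, not_lt] at hK' ⊢
    have hk0 : 1 ≤ k := Nat.one_le_iff_ne_zero.mpr fun h0 => hq.2 (h0 ▸ dvd_zero p)
    have h1 : 1 ≤ p ^ s * k := Nat.mul_pos (pow_pos hp'.pos s) hk0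
    apply hF
    omega

/-- **Straub 2014, Theorem 1.2 (9) for `𝐧 ∈ ℤ_{≥0}^4`, PROVED**: for a prime `p ≥ 5`, `r ≥ 1` and all
`n₁, n₂, n₃, n₄ ≥ 0`, `A(p^r 𝐧) ≡ A(p^{r−1} 𝐧) (mod p^{3r})` for the coefficients
`A(𝐧) = Σ_k C(n₁,k) C(n₃,k) C(n₁+n₂−k,n₁) C(n₃+n₄−k,n₃)` of `1/((1−x₁−x₂)(1−x₃−x₄) − x₁x₂x₃x₄)`.
Printed route: `A(p^r 𝐧) = A(p^r 𝐧; 0) + Σ_s G_s(p^r 𝐧)`, `G_s(p^r 𝐧) ≡ G_{s−1}(p^{r−1} 𝐧)` (Lemma 5.3 via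
Jacobsthal's congruence, tree `Jacobsthal.exists_ratio`), `G₀(p^r 𝐧) ≡ 0` (Lemmas 5.2, 5.4–5.6), and
`A(p^r 𝐧; 0) ≡ A(p^{r−1} 𝐧; 0)` (Jacobsthal, (36)). [cite: Straub2014, Theorem 1.2 (9)] -/
theorem straubA_prime_pow_modEq (h5 : 5 ≤ p) {r : ℕ} (hr : 1 ≤ r) (n₁ n₂ n₃ n₄ : ℕ) :
    (straubA (p ^ r * n₁) (p ^ r * n₂) (p ^ r * n₃) (p ^ r * n₄) : ℤ) ≡
      straubA (p ^ (r - 1) * n₁) (p ^ (r - 1) * n₂) (p ^ (r - 1) * n₃) (p ^ (r - 1) * n₄)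
        [ZMOD (p : ℤ) ^ (3 * r)] := by
  have hp' := hp.out
  have h3 : 3 < p := by omega
  -- the summands
  set t : ℕ → ℤ := fun K => (((p ^ r * n₁).choose K * (p ^ r * n₃).choose K *
    (p ^ r * n₁ + p ^ r * n₂ - K).choose (p ^ r * n₁) * (p ^ r * n₃ + p ^ r * n₄ - K).choose (p ^ r * n₃) : ℕ) : ℤ)
    with ht
  set t' : ℕ → ℤ := fun K => (((p ^ (r - 1) * n₁).choose K * (p ^ (r - 1) * n₃).choose K *
    (p ^ (r - 1) * n₁ + p ^ (r - 1) * n₂ - K).choose (p ^ (r - 1) * n₁) *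
    (p ^ (r - 1) * n₃ + p ^ (r - 1) * n₄ - K).choose (p ^ (r - 1) * n₃) : ℕ) : ℤ) with ht'
  have hNN' : p ^ (r - 1) * n₁ ≤ p ^ r * n₁ := Nat.mul_le_mul_right n₁ (Nat.pow_le_pow_right hp'.pos (by omega))
  have htN : ∀ K, p ^ r * n₁ < K → t K = 0 := fun K hK => by
    simp only [ht, Nat.choose_eq_zero_of_lt hK, zero_mul, Nat.cast_zero]
  have ht'N' : ∀ K, p ^ (r - 1) * n₁ < K → t' K = 0 := fun K hK => by
    simp only [ht', Nat.choose_eq_zero_of_lt hK, zero_mul, Nat.cast_zero]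
  have ht'N : ∀ K, p ^ r * n₁ < K → t' K = 0 := fun K hK => ht'N' K (lt_of_le_of_lt hNN' hK)
  have hA : (straubA (p ^ r * n₁) (p ^ r * n₂) (p ^ r * n₃) (p ^ r * n₄) : ℤ) =
      ∑ K ∈ range (p ^ r * n₁ + 1), t K := by
    simp only [straubA, Nat.cast_sum, ht]
  have hA' : (straubA (p ^ (r - 1) * n₁) (p ^ (r - 1) * n₂) (p ^ (r - 1) * n₃) (p ^ (r - 1) * n₄) : ℤ) =
      ∑ K ∈ range (p ^ r * n₁ + 1), t' K := by
    have h1 : (straubA (p ^ (r - 1) * n₁) (p ^ (r - 1) * n₂) (p ^ (r - 1) * n₃) (p ^ (r - 1) * n₄) : ℤ) =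
        ∑ K ∈ range (p ^ (r - 1) * n₁ + 1), t' K := by
      simp only [straubA, Nat.cast_sum, ht']
    rw [h1]
    refine Finset.sum_subset (fun x hx => Finset.mem_range.mpr
      (by have := Finset.mem_range.mp hx; omega)) fun K _ hK' => ?_
    have hlt : ¬ K < p ^ (r - 1) * n₁ + 1 := fun h => hK' (Finset.mem_range.mpr h)
    exact ht'N' K (by omega)
  -- regroup both sides by the valuation of `K`, with `S = N` (`N < p^N ≤ p^{N+1}`)
  have hS : p ^ r * n₁ < p ^ (p ^ r * n₁ + 1) :=
    (Nat.lt_pow_self hp'.one_lt).trans_le (Nat.pow_le_pow_right hp'.pos (by omega))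
  rw [hA, hA', sum_eq_sum_digits (p := p) hS t htN, sum_eq_sum_digits (p := p) hS t' ht'N]
  refine Int.ModEq.add ?_ ?_
  · -- `K = 0`: two instances of (36)
    simp only [ht, ht', Nat.choose_zero_right, one_mul, Nat.sub_zero]
    have h12 := Jacobsthal.choose_mul_prime_pow_modEq (p := p) h3 hr (n₁ + n₂) n₁
    have h34 := Jacobsthal.choose_mul_prime_pow_modEq (p := p) h3 hr (n₃ + n₄) n₃
    rw [← Int.natCast_modEq_iff] at h12 h34
    push_cast at h12 h34 ⊢
    rw [show p ^ r * n₁ + p ^ r * n₂ = (n₁ + n₂) * p ^ r by ring,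
      show p ^ r * n₃ + p ^ r * n₄ = (n₃ + n₄) * p ^ r by ring,
      show p ^ (r - 1) * n₁ + p ^ (r - 1) * n₂ = (n₁ + n₂) * p ^ (r - 1) by ring,
      show p ^ (r - 1) * n₃ + p ^ (r - 1) * n₄ = (n₃ + n₄) * p ^ (r - 1) by ring,
      show p ^ r * n₁ = n₁ * p ^ r by ring, show p ^ r * n₃ = n₃ * p ^ r by ring,
      show p ^ (r - 1) * n₁ = n₁ * p ^ (r - 1) by ring, show p ^ (r - 1) * n₃ = n₃ * p ^ (r - 1) by ring]
    exact h12.mul h34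
  · -- the `G_s`: `G₀(p^r 𝐧) ≡ 0` and `G_{s+1}(p^r 𝐧) ≡ G_s(p^{r−1} 𝐧)`, the top `G_N(p^{r−1} 𝐧)` being `0`
    rw [Finset.sum_range_succ' (fun s => ∑ k ∈ range (p ^ r * n₁ + 1), if p ∣ k then 0 else t (p ^ s * k)),
      Finset.sum_range_succ (fun s => ∑ k ∈ range (p ^ r * n₁ + 1), if p ∣ k then 0 else t' (p ^ s * k))]
    have hG0 : ∑ k ∈ range (p ^ r * n₁ + 1), (if p ∣ k then 0 else t (p ^ 0 * k)) ≡ 0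
        [ZMOD (p : ℤ) ^ (3 * r)] := by
      simp only [pow_zero, one_mul, ht]
      exact Int.modEq_zero_iff_dvd.mpr (pow_dvd_sum_not_dvd_term (p := p) h5 hr n₁ n₂ n₃ n₄)
    have hGtop : ∑ k ∈ range (p ^ r * n₁ + 1), (if p ∣ k then 0 else t' (p ^ (p ^ r * n₁) * k)) = 0 := by
      refine Finset.sum_eq_zero fun k _ => ?_
      split_ifs with hk
      · rfl
      · have hk1 : 1 ≤ k := Nat.one_le_iff_ne_zero.mpr fun h0 => hk (h0 ▸ dvd_zero p)
        apply ht'N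
        have h1 : p ^ r * n₁ < p ^ (p ^ r * n₁) := Nat.lt_pow_self hp'.one_lt
        have h2 : p ^ (p ^ r * n₁) ≤ p ^ (p ^ r * n₁) * k := Nat.le_mul_of_pos_right _ hk1
        omega
    have hGs : ∀ s ∈ range (p ^ r * n₁), ∑ k ∈ range (p ^ r * n₁ + 1), (if p ∣ k then 0 else t (p ^ (s + 1) * k)) ≡
        ∑ k ∈ range (p ^ r * n₁ + 1), (if p ∣ k then 0 else t' (p ^ s * k)) [ZMOD (p : ℤ) ^ (3 * r)] := by
      intro s _
      refine Int.ModEq.sum fun k _ => ?_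
      split_ifs with hk
      · rfl
      · have hk1 : 1 ≤ k := Nat.one_le_iff_ne_zero.mpr fun h0 => hk (h0 ▸ dvd_zero p)
        have h := term_modEq (p := p) h3 hr (show 1 ≤ s + 1 by omega) hk1 hk n₁ n₂ n₃ n₄
        simp only [Nat.add_sub_cancel] at h
        simpa only [ht, ht'] using h
    rw [hGtop, add_zero]
    have := (Int.ModEq.sum hGs).add hG0
    rw [add_zero] at this
    exact this

/-- **Straub 2014, Theorem 1.2** — the named fact `MultivariateAperyNumbers.theorem12` is a THEOREM.
[cite: Straub2014, Theorem 1.2 (9)] -/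
theorem theorem12_holds : MultivariateAperyNumbers.theorem12 := by
  intro p hpr h5 r hr n₁ n₂ n₃ n₄
  haveI : Fact p.Prime := ⟨hpr⟩
  exact straubA_prime_pow_modEq (p := p) h5 hr n₁ n₂ n₃ n₄

/-- **Coster 1988 (Gessel 1982 / Mimura 1983 for `r = 1`): `A(p^r m) ≡ A(p^{r−1} m) (mod p^{3r})` for the Apéry
numbers**, `p ≥ 5`, `r ≥ 1` — the named fact `MultivariateAperyNumbers.coster1988_supercongruence` is a THEOREM
(diagonal of Theorem 1.2). [cite: Straub2014, (2)] [cite: Coster1988, (two-term supercongruence)] -/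
theorem coster1988_supercongruence_holds : MultivariateAperyNumbers.coster1988_supercongruence :=
  MultivariateAperyNumbers.coster1988_of_theorem12 theorem12_holds

end Assembly

end Literature.Combinatorics.Enumerative.MultivariateAperyPrimePowerProofs
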